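import Mathlib
import HarnessLib
import Literature.Computability.AlgebraicComplexity.TensorSemiringSpectrum
import Summits.MatrixMultiplication.MatrixMultiplication.Theorems.OutsiderSandwichBlockOneOperational
import Summits.MatrixMultiplication.MatrixMultiplication.Theorems.OutsiderSandwichBlockNormalForm
import Summits.MatrixMultiplication.MatrixMultiplication.Theorems.FarEdgeDescentCouplingBridge
import Summits.MatrixMultiplication.MatrixMultiplication.Theorems.OutsiderSandwichQuantumCorner

/-!
# Outsider sandwich — the EXCHANGE-RATE CALCULUS of the one-block leaf (decomp-mm lens-4, g20; part 1)

Route `route-MatrixMultiplication-OutsiderSandwich` (cut of record UNCHANGED; β-reading `BlockOneIsMM ∧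
CouplingMergeOptimal ∧ BlockOneReduction` pre-certified, held by the writer).  `C₁ = coupling₁` is the free tight
`4 × 4 × 4` block of `cw₂^{⊗2}` — the tensor of `(A; u, w) ↦ (Au, Aᵀw)` (`≅ pairTensor 2`).  The attacked
ω-free leaf `BlockOneIsMM` (27147, NECESSARY for `ω = 2`) is, by g19's dictionary
(`blockOneIsMM_iff_asymptoticRestriction`), the registered stub
`∀ ε > 0, cofinally in N, ∃ B ≤ 2^{εN}, ⟨B⟩ ⊠ C₁^{⊠N} ⊵ ⟨2,2,2⟩^{⊠N}`.

Lens-4 (minimal counterexample / extremal) reading, part 1 — with `Helped N B :⟺ ⟨B⟩ ⊠ C₁^{⊠N} ⊵ ⟨2,2,2⟩^{⊠N}`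
and `ExponentAchieved θ :⟺ cofinally some B ≤ 2^{θN} is Helped` (all hypothesis-free):
* §1 EXCHANGE ALGEBRA in Strassen's ordered semiring `T(ℂ)`: `Helped N B ⟺ [⟨2,2,2⟩]^N ≤ B·[C₁]^N`; help
  counts MULTIPLY (`helped_mul`, `helped_pow`), so ONE certificate at ONE level propagates
  (`exponentAchieved_of_helped`); the achieved rates form an up-set and the leaf takes the `∃`-form
  **`BlockOneIsMM ⟺ ∀ θ > 0, ∃ N ≥ 1, ∃ B ≤ 2^{θN}, Helped N B`** (`blockOneIsMM_iff_exists_certificate`).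
* §2 NO FINITE WITNESS: `B ≥ 2` whenever `Helped N B`, `N ≥ 1` (`two_le_of_helped`, from lens-2's degeneration
  antichain `coupling₁_pow_not_algDegeneratesTo_matMul_pow`), hence `ExponentAchieved θ ⟹ θ > 0`: rate `0` is
  attained at NO finite level — a counterexample to the leaf is a positive THRESHOLD below which nothing is
  achieved (`not_blockOneIsMM_iff_threshold`), never a finite configuration.
* §3 EXPLICIT RUNGS: `⟨n⟩ ⊠ pairTensor n ⊵ ⟨n,n,n⟩` with `0/1` matrices, so `Helped 1 2` and, with §2,
  **`r(1) = 2` exactly** (`exchangeRate_one`); `Helped N (2^N)`; rate `1` achieved; rate `1/2` from any two-copy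
  level-2 certificate (`exponentAchieved_half_of_levelTwo`, the docking point for lens-2's symmetric cover
  `matMulSq_le_unitTwo_coupling₁Sq`, p805535); rate `log₂ B / N` from any certificate.
Part 2 (`OutsiderSandwichExchangeExponent`): the laser floor `θ > ω − 2`, `θ⋆`, `r(N)`, cofinal = eventual.

[Strassen1988, Thm. 3.8]; [Zuiddam2018, §2.3]; [ChristandlVranaZuiddam2023, §1.1–1.2]; [Blaser2013, §5, Thm. 6.3].
-/

noncomputable section

open Filter Topology
open Literature.Computability.AlgebraicComplexity
open Summit.MatrixMultiplication.MatrixMultiplication.Theorems.OutsiderSandwichCoupling (coupling₁)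
open Summit.MatrixMultiplication.MatrixMultiplication.Theorems.OutsiderSandwichBlockNormalForm
  (pairTensor pairTensor_restrictsTo_coupling₁ coupling₁_restrictsTo_pairTensor)

namespace Summit.MatrixMultiplication.MatrixMultiplication.Theorems.OutsiderSandwichExchangeRate


/-! ## 0. The two predicates of the stub -/

/-- **`Helped N B`**: `⟨B⟩ ⊠ C₁^{⊠N} ⊵ ⟨2,2,2⟩^{⊠N}` — `B` disjoint copies of the `N`-th Kronecker power of
the block restrict to the `N`-th Kronecker power of `2 × 2` matrix multiplication (the inner clause of
`stub_blockOneAsymptoticRestriction`). [cite: Strassen1988, Thm. 3.8] -/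
def Helped (N B : ℕ) : Prop :=
  TensorRestrictsTo (kroneckerTensor (unitTensor ℂ B) (kroneckerPow coupling₁ N))
    (kroneckerPow (matMulTensor ℂ 2 2 2) N)

/-- **`ExponentAchieved θ`**: the stub's matrix at rate `θ` — cofinally in `N`, some `B ≤ 2^{θN}` copies
help. (`stub ⟺ ∀ θ > 0, ExponentAchieved θ`.) [cite: Strassen1988, Thm. 3.8] -/
def ExponentAchieved (θ : ℝ) : Prop :=
  ∀ N₀ : ℕ, ∃ N : ℕ, N₀ ≤ N ∧ ∃ B : ℕ, Helped N B ∧ (B : ℝ) ≤ (2 : ℝ) ^ (θ * N)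

/-- **`BlockOneIsMM ⟺ every positive rate is achieved`** (g19's dictionary, re-read).
[cite: Strassen1988, Thm. 3.8] -/
theorem blockOneIsMM_iff_forall_exponentAchieved :
    Theses.OutsiderSandwich.BlockOneIsMM ↔ ∀ θ : ℝ, 0 < θ → ExponentAchieved θ :=
  OutsiderSandwichBlockOneOperational.blockOneIsMM_iff_asymptoticRestriction

/-! ## 1. Exchange algebra in `T(ℂ)` -/

/-- `Helped N B ⟺ [⟨2,2,2⟩]^N ≤ B · [C₁]^N` in Strassen's ordered semiring `T(ℂ)`.
[cite: Zuiddam2018, §2.3] -/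
theorem helped_iff_le (N B : ℕ) :
    Helped N B ↔ TensorClass.mk (matMulTensor ℂ 2 2 2) ^ N ≤
      (B : TensorClass ℂ) * TensorClass.mk coupling₁ ^ N := by
  unfold Helped
  rw [TensorClass.mk_pow, TensorClass.mk_pow, TensorClass.natCast_eq_mk, TensorClass.mk_mul_mk,
    TensorClass.mk_le_mk_iff]

/-- **Help counts multiply**: `Helped M B → Helped N B' → Helped (M + N) (B B')`. [folklore] -/
theorem helped_mul {M N B B' : ℕ} (h : Helped M B) (h' : Helped N B') : Helped (M + N) (B * B') := by
  rw [helped_iff_le] at h h' ⊢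
  calc TensorClass.mk (matMulTensor ℂ 2 2 2) ^ (M + N)
        = TensorClass.mk (matMulTensor ℂ 2 2 2) ^ M * TensorClass.mk (matMulTensor ℂ 2 2 2) ^ N :=
          pow_add _ _ _
    _ ≤ ((B : TensorClass ℂ) * TensorClass.mk coupling₁ ^ M) *
          ((B' : TensorClass ℂ) * TensorClass.mk coupling₁ ^ N) := TensorClass.mul_le_mul h h'
    _ = ((B * B' : ℕ) : TensorClass ℂ) * TensorClass.mk coupling₁ ^ (M + N) := by
          push_cast; ring

/-- `Helped 0 1` (empty products). [folklore] -/
theorem helped_zero_one : Helped 0 1 := by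
  rw [helped_iff_le, pow_zero, pow_zero, Nat.cast_one, mul_one]

/-- **Powers**: `Helped N B → Helped (k N) (B^k)`. [folklore] -/
theorem helped_pow {N B : ℕ} (h : Helped N B) (k : ℕ) : Helped (k * N) (B ^ k) := by
  induction k with
  | zero => simpa using helped_zero_one
  | succ k ih =>
    have e₁ : (k + 1) * N = k * N + N := by ring
    have e₂ : B ^ (k + 1) = B ^ k * B := pow_succ B k
    rw [e₁, e₂]
    exact helped_mul ih h

/-- More copies help as well. [folklore] -/
theorem helped_mono {N B B' : ℕ} (h : Helped N B) (hB : B ≤ B') : Helped N B' := by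
  rw [helped_iff_le] at h ⊢
  exact h.trans (TensorClass.mul_le_mul (TensorClass.natCast_le_natCast_iff.2 hB) le_rfl)

/-- **One certificate propagates**: a single `Helped N B` with `B ≤ 2^{θN}` (`N ≥ 1`) gives the stub's
matrix at rate `θ` (along the multiples of `N`). [folklore] -/
theorem exponentAchieved_of_helped {N B : ℕ} {θ : ℝ} (hN : 1 ≤ N) (h : Helped N B)
    (hB : (B : ℝ) ≤ (2 : ℝ) ^ (θ * N)) : ExponentAchieved θ := by
  intro N₀
  refine ⟨(N₀ + 1) * N, ?_, B ^ (N₀ + 1), helped_pow h (N₀ + 1), ?_⟩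
  · calc N₀ ≤ N₀ + 1 := N₀.le_succ
      _ = (N₀ + 1) * 1 := (mul_one _).symm
      _ ≤ (N₀ + 1) * N := Nat.mul_le_mul_left _ hN
  · have h0 : (0 : ℝ) ≤ B := Nat.cast_nonneg B
    calc ((B ^ (N₀ + 1) : ℕ) : ℝ) = (B : ℝ) ^ (N₀ + 1) := by push_cast; ring
      _ ≤ ((2 : ℝ) ^ (θ * N)) ^ (N₀ + 1) := pow_le_pow_left₀ h0 hB _
      _ = (2 : ℝ) ^ (θ * (((N₀ + 1) * N : ℕ) : ℝ)) := by
          rw [← Real.rpow_mul_natCast (by norm_num : (0 : ℝ) ≤ 2)]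
          congr 1
          push_cast
          ring

/-- The achieved rates form an up-set. [folklore] -/
theorem ExponentAchieved.mono {θ θ' : ℝ} (h : ExponentAchieved θ) (hle : θ ≤ θ') :
    ExponentAchieved θ' := by
  intro N₀
  obtain ⟨N, hN, B, hB, hle'⟩ := h N₀
  exact ⟨N, hN, B, hB, hle'.trans (Real.rpow_le_rpow_of_exponent_le (by norm_num)
    (mul_le_mul_of_nonneg_right hle (Nat.cast_nonneg N)))⟩

/-- `ExponentAchieved θ ⟺ ONE certificate at ONE level`. [folklore] -/
theorem exponentAchieved_iff_exists (θ : ℝ) :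
    ExponentAchieved θ ↔ ∃ N : ℕ, 1 ≤ N ∧ ∃ B : ℕ, Helped N B ∧ (B : ℝ) ≤ (2 : ℝ) ^ (θ * N) := by
  constructor
  · intro h
    exact h 1
  · rintro ⟨N, hN, B, hB, hle⟩
    exact exponentAchieved_of_helped hN hB hle

/-- **The leaf in `∃`-form**: `BlockOneIsMM ⟺ ∀ θ > 0, ∃ N ≥ 1, ∃ B ≤ 2^{θN}, ⟨B⟩ ⊠ C₁^{⊠N} ⊵ ⟨2,2,2⟩^{⊠N}`
— one finite certificate per rate. [cite: Strassen1988, Thm. 3.8] -/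
theorem blockOneIsMM_iff_exists_certificate :
    Theses.OutsiderSandwich.BlockOneIsMM ↔
      ∀ θ : ℝ, 0 < θ → ∃ N : ℕ, 1 ≤ N ∧ ∃ B : ℕ, Helped N B ∧ (B : ℝ) ≤ (2 : ℝ) ^ (θ * N) := by
  rw [blockOneIsMM_iff_forall_exponentAchieved]
  exact forall₂_congr fun θ _ => exponentAchieved_iff_exists θ

/-- **`ω = 2 ⟺ (one certificate per rate) ∧ CouplingMergeOptimal`.** [cite: Strassen1988, Thm. 3.8] -/
theorem summit_iff_exists_certificate_and_couplingMergeOptimal :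
    _root_.MatrixMultiplication ↔
      (∀ θ : ℝ, 0 < θ → ∃ N : ℕ, 1 ≤ N ∧ ∃ B : ℕ, Helped N B ∧ (B : ℝ) ≤ (2 : ℝ) ^ (θ * N)) ∧
      Theses.OutsiderSandwich.CouplingMergeOptimal :=
  OutsiderSandwichBlockOneItems.summit_iff_blockOneIsMM_items.trans
    (and_congr blockOneIsMM_iff_exists_certificate Iff.rfl)

/-! ## 2. No finite witness: `r(N) ≥ 2` at every level, `θ > 0` for every achieved rate -/

/-- `1 ≤ [⟨2,2,2⟩]^N` in `T(ℂ)`. [cite: ChristandlVranaZuiddam2023, §1.2] -/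
theorem one_le_mk_matMul_pow (N : ℕ) :
    (1 : TensorClass ℂ) ≤ TensorClass.mk (matMulTensor ℂ 2 2 2) ^ N := by
  induction N with
  | zero => rw [pow_zero]
  | succ k ih =>
    rw [pow_succ]
    calc (1 : TensorClass ℂ) = 1 * 1 := (mul_one 1).symm
      _ ≤ TensorClass.mk (matMulTensor ℂ 2 2 2) ^ k * TensorClass.mk (matMulTensor ℂ 2 2 2) :=
          TensorClass.mul_le_mul ih
            (TensorClass.one_le_mk OutsiderSandwichQuantumCorner.matMulTensor_two_ne_zero)

/-- Zero copies never help. [folklore] -/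
theorem not_helped_zero (N : ℕ) : ¬ Helped N 0 := by
  intro h
  rw [helped_iff_le, Nat.cast_zero, zero_mul] at h
  have h1 : ((1 : ℕ) : TensorClass ℂ) ≤ ((0 : ℕ) : TensorClass ℂ) := by
    rw [Nat.cast_one, Nat.cast_zero]
    exact (one_le_mk_matMul_pow N).trans h
  exact absurd (TensorClass.natCast_le_natCast_iff.1 h1) (by norm_num)

/-- **One copy never helps** (`N ≥ 1`): `C₁^{⊠N} ⋭ ⟨2,2,2⟩^{⊠N}` even as a degeneration (lens-2's antichain,
Bläser's Kernel II transported). [cite: Blaser2013, Thm. 6.3] -/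
theorem not_helped_one {N : ℕ} (hN : 1 ≤ N) : ¬ Helped N 1 := by
  intro h
  rw [helped_iff_le, Nat.cast_one, one_mul, TensorClass.mk_pow, TensorClass.mk_pow,
    TensorClass.mk_le_mk_iff] at h
  exact FarEdgeDescentCouplingBridge.coupling₁_pow_not_algDegeneratesTo_matMul_pow N hN h.algDegeneratesTo

/-- **`r(N) ≥ 2` for every `N ≥ 1`**: any help count is at least two. [cite: Blaser2013, Thm. 6.3] -/
theorem two_le_of_helped {N B : ℕ} (hN : 1 ≤ N) (h : Helped N B) : 2 ≤ B := by
  by_contra hB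
  push Not at hB
  interval_cases B
  · exact not_helped_zero N h
  · exact not_helped_one hN h

/-- **Rate `0` is attained at no finite level; every achieved rate is positive.** So the leaf
`∀ θ > 0, ExponentAchieved θ` is a genuine limit statement: no single level decides it. [cite: Blaser2013, Thm. 6.3] -/
theorem ExponentAchieved.pos {θ : ℝ} (h : ExponentAchieved θ) : 0 < θ := by
  by_contra hθ
  push Not at hθ
  obtain ⟨N, hN, B, hB, hle⟩ := h 1
  have h2 : (2 : ℝ) ≤ B := by exact_mod_cast two_le_of_helped hN hB
  have hN' : (0 : ℝ) ≤ N := Nat.cast_nonneg N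
  have hθN : θ * N ≤ 0 := by nlinarith
  have h1 : (2 : ℝ) ^ (θ * N) ≤ 1 := Real.rpow_le_one_of_one_le_of_nonpos (by norm_num) hθN
  linarith

/-- `¬ ExponentAchieved θ` for `θ ≤ 0`. [cite: Blaser2013, Thm. 6.3] -/
theorem not_exponentAchieved_of_nonpos {θ : ℝ} (hθ : θ ≤ 0) : ¬ ExponentAchieved θ :=
  fun h => absurd h.pos (not_lt.2 hθ)

/-- **The negation of the leaf is a positive THRESHOLD, and below a non-achieved rate nothing is
achieved** (down-set): `¬ BlockOneIsMM ⟺ ∃ θ > 0, ∀ θ' ≤ θ, ¬ ExponentAchieved θ'`. [cite: Strassen1988, Thm. 3.8] -/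
theorem not_blockOneIsMM_iff_threshold :
    ¬ Theses.OutsiderSandwich.BlockOneIsMM ↔
      ∃ θ : ℝ, 0 < θ ∧ ∀ θ' : ℝ, θ' ≤ θ → ¬ ExponentAchieved θ' := by
  rw [blockOneIsMM_iff_forall_exponentAchieved]
  constructor
  · intro h
    push Not at h
    obtain ⟨θ, hθ, hnot⟩ := h
    exact ⟨θ, hθ, fun θ' hle h' => hnot (h'.mono hle)⟩
  · rintro ⟨θ, hθ, hnot⟩ H
    exact hnot θ le_rfl (H θ hθ)

/-! ## 3. Rungs in the stub's currency -/

/-- **`n` pair maps compute an `n × n` matrix product**: `⟨n⟩ ⊠ pairTensor n ⊵ ⟨n,n,n⟩` (copy `μ` is fed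
`A := X`, `w := X`-column index data `X_{κμ}` on the `w`-half and reads `Z_{κν} ∋ X_{κμ} Y_{μν}` off the
`Aᵀw`-half; the `Au`-half is unused).  Explicit `0/1` restriction matrices. [cite: Blaser2013, §5] -/
theorem restrictsTo_matMul_of_unit_kronecker_pairTensor (n : ℕ) :
    TensorRestrictsTo (kroneckerTensor (unitTensor ℂ n) (pairTensor n)) (matMulTensor ℂ n n n) := by
  classical
  refine ⟨fun a' a => if a.2 = a' then 1 else 0,
    fun b' b => if b = (b'.2, ((1 : Fin 2), b'.1)) then 1 else 0,
    fun c' c => if c = (c'.1, ((0 : Fin 2), c'.2)) then 1 else 0, fun a' b' c' => ?_⟩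
  rw [Finset.sum_eq_single (b'.2, a')]
  · -- the surviving `a = (μ, (κ, ν))`
    rw [Finset.sum_eq_single (b'.2, ((1 : Fin 2), b'.1))]
    · rw [Finset.sum_eq_single (c'.1, ((0 : Fin 2), c'.2))]
      · have h10 : ¬ ((1 : Fin 2) = 0) := by decide
        obtain ⟨κ, ν⟩ := a'
        obtain ⟨κ', μ⟩ := b'
        obtain ⟨μ', ν'⟩ := c'
        by_cases h₁ : κ = κ' <;> by_cases h₂ : μ = μ' <;> by_cases h₃ : ν = ν' <;>
          simp [kroneckerTensor_apply, unitTensor, pairTensor, matMulTensor, h10, h₁, h₂, h₃,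
            (eq_comm : κ' = κ ↔ κ = κ'), (eq_comm : ν' = ν ↔ ν = ν')]
      · intro c _ hc
        simp [hc]
      · intro h
        exact absurd (Finset.mem_univ _) h
    · intro b _ hb
      simp [hb]
    · intro h
      exact absurd (Finset.mem_univ _) h
  · -- every other `a` contributes nothing
    intro a _ ha
    apply Finset.sum_eq_zero
    intro b _
    apply Finset.sum_eq_zero
    intro c _
    by_cases h2 : a.2 = a'
    · have h1 : a.1 ≠ b'.2 := fun h1 => ha (Prod.ext h1 h2)
      by_cases hb : b = (b'.2, ((1 : Fin 2), b'.1))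
      · subst hb
        simp [kroneckerTensor_apply, unitTensor, h1]
      · simp [hb]
    · simp [h2]
  · intro h
    exact absurd (Finset.mem_univ _) h

/-- **Rung at level 1: `Helped 1 2`** (`⟨2⟩ ⊠ C₁ ⊵ ⟨2,2,2⟩`, rate `1`). [cite: Blaser2013, §5] -/
theorem helped_one_two : Helped 1 2 := by
  rw [helped_iff_le, pow_one, pow_one,
    TensorClass.mk_eq_mk pairTensor_restrictsTo_coupling₁ coupling₁_restrictsTo_pairTensor,
    TensorClass.natCast_eq_mk, TensorClass.mk_mul_mk, TensorClass.mk_le_mk_iff]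
  exact restrictsTo_matMul_of_unit_kronecker_pairTensor 2

/-- **`r(1) = 2` exactly**: one copy does not help at level `1`, two do. [cite: Blaser2013, Thm. 6.3] -/
theorem exchangeRate_one : ¬ Helped 1 1 ∧ Helped 1 2 :=
  ⟨not_helped_one le_rfl, helped_one_two⟩

/-- **`r(N) ≤ 2^N`**: `Helped N (2^N)` for every `N`. [folklore] -/
theorem helped_pow_two_pow (N : ℕ) : Helped N (2 ^ N) := by
  simpa using helped_pow helped_one_two N

/-- **Rate `1` is achieved.** [folklore] -/
theorem exponentAchieved_one : ExponentAchieved 1 :=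
  exponentAchieved_of_helped le_rfl helped_one_two (by norm_num)

/-- **Rate `1/2` from any two-copy certificate at level `2`** — the docking point for lens-2's
`FarEdgeDescentSymmetricCover.matMulSq_le_unitTwo_coupling₁Sq : Helped 2 2` (symmetric cover,
`r(2) = 2`). [folklore] -/
theorem exponentAchieved_half_of_levelTwo (h : Helped 2 2) : ExponentAchieved (1 / 2) :=
  exponentAchieved_of_helped (by norm_num) h (by norm_num)

/-- More generally: a certificate with `B` copies at level `N ≥ 1` achieves rate `log₂ B / N`. [folklore] -/
theorem exponentAchieved_logb_of_helped {N B : ℕ} (hN : 1 ≤ N) (hB : 1 ≤ B) (h : Helped N B) :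
    ExponentAchieved (Real.logb 2 B / N) := by
  refine exponentAchieved_of_helped hN h (le_of_eq ?_)
  have hN' : (N : ℝ) ≠ 0 := by exact_mod_cast (show N ≠ 0 by omega)
  have hB' : (0 : ℝ) < B := by exact_mod_cast hB
  rw [div_mul_cancel₀ _ hN', Real.rpow_logb (by norm_num) (by norm_num) hB']

end Summit.MatrixMultiplication.MatrixMultiplication.Theorems.OutsiderSandwichExchangeRate

end
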